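import Mathlib
import HarnessLib
import HarnessLib.Audit
import Summits.NavierStokesRegularity.Statement
import Literature.Analysis.FluidPDE.ClassicalSolution
import Literature.Analysis.FluidPDE.LerayHopf
import Literature.Analysis.FluidPDE.SuitableWeak
import Literature.Analysis.FluidPDE.NSWave0
import Summits.NavierStokesRegularity.NavierStokesRegularity.Theorems.TypeICertificateLadderNoBlowupToClay

/-!
Route: SelfMixingDichotomy

DORMANT since 2026-09-03T10:19:17Z (reconciler: no traction for 5 d (last activity statement-checked at 2026-08-29T09:17:08Z); parked, not closed — `ledger route dormant route-NavierStokesRegularity-SelfMixingDichotomy --off` to reactiv) — unstaffed, not closed; items shared with open routes are served there. `ledger route dormant <id> --off` reactivates.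

Route SelfMixingDichotomy — NavierStokesRegularity (Clay A), positive side; realises idea card
NavierStokesRegularity/NavierStokesRegularity/self-mixing-dichotomy-enhanced-dissipation
(self-generated mixing dichotomy: per-scale structure/randomness split of the solution's OWN
advection, enhanced dissipation as the randomness payoff).

THESIS X ("it suffices to show") = MixingPayoff ∧ CoherentScaleExclusion ∧ SequentialTypeIExclusion,
three statements about a finite-energy (Leray–Hopf) classical solution u of NS with ν = 1 on
ℝ³×[0,T) from a rapidly decaying datum, at a space point x₀ and the final time T. Per parabolic
scale r classify the drift u on the cylinder Q_r(T,x₀) by ONE dimensionless functional, the scalar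
dissipation factor:
  MIX(u,T,x₀,r,δ) :⇔ every smooth rapidly decaying θ solving ∂ₜθ + u·∇θ = Δθ on [T−r², T−r²/2]×ℝ³
with supp θ(T−r²) ⊆ B_r(x₀) satisfies ∫θ(T−r²/2)² ≤ δ² ∫θ(T−r²)²
(diffusivity = viscosity; total L² is Galilean/rotation invariant, so sweeping and solid rotation do
not count — MIX with δ below the pure-heat constant c_heat ≈ 0.6 means genuine gradient creation,
i.e. u is quantitatively relaxation/dissipation-enhancing at scale r in the sense of
Constantin–Kiselev–Ryzhik–Zlatoš / Zlatoš), and by the local Reynolds number C(r) = r⁻²∫∫_{Q_r}|u|³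
(in-tree cknC). Conclusion in all three: BDD(u,T,x₀) :⇔ u is bounded on (T−ρ²,T)×B_ρ(x₀) for some
ρ>0.
  P  MixingPayoff (crux, rank 2): ∃δ>0: if MIX(r,δ) holds for all sufficiently small r, then BDD.
  S2 CoherentScaleExclusion (crux, rank 3): ∀δ>0 ∃M: if along a sequence r_k→0 both M ≤ C(r_k) and
¬MIX(r_k,δ), then BDD.
  S1 SequentialTypeIExclusion (crux, rank 4): ∀M: if C(r_k) ≤ M along a sequence r_k→0, then BDD.
The trichotomy {cofinitely mixing} / {i.o. high-Re non-mixing} / {i.o. low-Re} is exhaustive by pure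
logic, so X ⇒ u bounded near every (T,x₀) ⇒ (support glue LocalToGlobal: ν-scaling, far field,
continuation of bounded Leray–Hopf solutions) NoBlowup ⇒ (shared stmt-0055 NoBlowupToClay)
NavierStokesRegularity. Assembly = P → S2 → S1 → LocalToGlobal → NoBlowupToClay →
NavierStokesRegularity, PROVED sorry-free in the planner's Sketch.lean (lean check rc 0).

Lean (one line, elaborates; the three conjuncts are the decls MixingPayoff, CoherentScaleExclusion,
SequentialTypeIExclusion of the route file):
Thesis := MixingPayoff ∧ CoherentScaleExclusion ∧ SequentialTypeIExclusion, over
Literature.Analysis.FluidPDE.{IsClassicalNSSolutionOn, IsLerayHopfOn, HasRapidSpatialDecay,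
IsSmoothSpaceTimeOn, HasUniformRapidDecayOn, timeDerivWithin, cknC}, Mathlib gradient /
Laplacian.laplacian / Metric.ball, and the root constant NavierStokesRegularity.

Rationale: WHY THIS LINE. Structure-vs-randomness in SCALE space for the solution's own advection operator u·∇
(card self-mixing-dichotomy-enhanced-dissipation). At a singular point every small parabolic scale
is loaded (CKN1982/Lin1998 ε-regularity; one-scale velocity form WangWuZhou2019); classify each
scale by the scalar dissipation factor of u as a stirrer (the relaxation- /dissipation-enhancing
notion of ConstantinEtAl2008 = CKRZ Annals 2008, Zlatos2010, quantified as in FengIyer2019,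
ZelatiDelgadinoElgindi2019) and by the local Reynolds number C(r). Disorder pays: mixing scales must
convert the cascade's disorder into dissipation (payoff theorems exist for OTHER blow-ups driven by
PRESCRIBED stirring: KiselevXu2016, IyerXuZlatos2021; for NS only with noise standing in for the
small scales: FlandoliLuo2021; NS-internal 'mixedness pays dissipation': Grujic2012,
BradshawFarhatGrujic2018, GrujicXu2024). Order pays too: non-mixing high-Re scales carry an
approximate continuous symmetry (CKRZ: not relaxation-enhancing ⇔ u·∇ has H¹ eigenfunctions; radial
data in a vortex core) and are handed to rigidity/Liouville technology; low-Re scales are Type-I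
windows (KNSS2009, SereginSverak2009, AlbrittonBarker2019, Seregin2024). Imported areas:
mixing/enhanced-dissipation theory of passive scalars (dynamical systems/PDE), partial regularity
(CKN), blow-up classification. Refuter hinges of the card are designed out: the payoff is posed for
SCALARS only (passive-VECTOR enhanced dissipation is false for mixing fields: fast-dynamo theorems
arXiv:2407.18028, arXiv:2603.09861, arXiv:2608.02586), and exhaustiveness of the dichotomy is pure
logic (Assembly proved in Sketch.lean), the content sitting in three separately falsifiable cruxes.
RANKED CRUXES (ν = 1; u classical Leray–Hopf on ℝ³×[0,T) from a rapidly decaying datum; conclusion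
BDD = u bounded on some (T−ρ²,T)×B_ρ(x₀)).
#2 MixingPayoff P: ∃δ>0, MIX(r,δ) for all small r at (T,x₀) ⇒ BDD. Hardest and the card's raison
d'être. Why it might fail: the race is scale-critical with O(1) constants — self-advection cannot
dissipate a scale-r blob faster than ~one turnover, stretching acts on the same clock
(EnergySupercriticality moral); intended path MIX ⇒ sparseness of |ω| super-level sets at the
analyticity scale ⇒ Grujic2012/BradshawFarhatGrujic2018 Thm 19, where the known gap is X_{1/2}
needed vs X_{1/3} a priori.
#3 CoherentScaleExclusion S2: ∀δ ∃M, scales with C(r_k) ≥ M and ¬MIX(r_k,δ) cannot recur down to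
r_k→0 at a singular point. Why it might fail: non-mixing ⇔ H¹-eigenstructure of u·∇ (CKRZ) is far
weaker than axisymmetry; no Liouville/ε-regularity theorem covers 'approximately symmetric'
profiles; axisymmetric-with-swirl regularity is open and Hou2022PotentiallySingularNS is
axisymmetric and coherent.
#4 SequentialTypeIExclusion S1: ∀M, liminf_{r→0} C(r) ≤ M ⇒ BDD. Why it might fail: the sup-form is
Type I exclusion, open and tied to the KNSS Liouville conjecture (Seregin2014Notes PDF p.113 Prop
3.11, p.114; AlbrittonBarker2019 Thm 1.1); the liminf form is stronger still (scale-intermittent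
Type II with Type-I windows; even small liminf E needs limsup E < M in Seregin2014Notes PDF p.101
Prop 1.5). Small M is known (one-scale ε-regularity, WangWuZhou2019).
Support: LocalToGlobal (ν→1 scaling ClassicalSolutionRescale/LerayHopfNSRescale, far-field bound
LerayFarFieldEpsilonRegularity*, Tao2011 slab bounds, hasSmoothExtensionPast_of_bounded_holds
PROVED); NoBlowupToClay = stmt-NavierStokesRegularity-0055 (shared). Proved cone facts leaned on:
ckn_epsilon_regularity_holds, hasSmoothExtensionPast_of_bounded_holds.
KILL CRITERIA. A finite-energy blow-up whose final-time point is cofinitely δ-mixing for every δ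
(refutes P), or with recurring coherent high-Re scales (refutes S2), or with liminf C < ∞ (refutes
S1) — each is ¬Clay(A) and closes the route refuted:<Decl>. Cheap partial kills that force a RESTATE
rather than a close: (i) a rigorous example (any divergence-free smooth u, not necessarily NS) where
MIX(r,δ) at all small scales coexists with unbounded growth of a scalar SUB-solution f of ∂ₜf + u·∇f
− Δf ≤ |∇u| f near (T,x₀) — kills the intended proof of P (Constantin's |ω| inequality) and sends P
to the sparseness path only; (ii) a proof that MIX(r,δ) with δ < c_heat forces C(r) ≥ M(δ)→∞ would
merge S1 into S2's complement (simplify, not kill).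
DELIBERATELY NOT DECOMPOSED (layer 2, by glued splits once a crux closes): P ⇐ {MIX ⇒ volumetric
sparseness of |ω| super-level sets in Q_{r/2}} ∧ {localised Grujić criterion}; S2 ⇐ {¬MIX ∧ C ≥ M ⇒
compactness of rescaled profiles with a nontrivial H¹ first integral of the limit drift} ∧
{Liouville for such profiles, axisymmetric class first: knss_no_axisymmetric_typeI,
SereginZajaczkowski2007}; S1 ⇐ {liminf ⇒ sup bootstrap along mixing-free windows} ∧
{¬TypeISingularityExists}. Also not filed: the definition item DissipatesAtScale (requested
separately; signatures inline it today), Prandtl-number variants of MIX, and any stochastic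
(Flandoli–Luo) version.
NUMBERS. Items at open: 7 (3 cruxes, 2 support, target, assembly). Pure-heat benchmark for MIX:
Gaussian of width s after time r²/2 keeps (s²/(s²+r²))^{3/4} of its L² norm, = 2^{-3/4} ≈ 0.59 at s
= r; so δ ≤ 0.1 forces active straining of every sub-blob of B_r(x₀) down to scale ≈ r/4. Known
Liouville/Type-I exclusions usable in S1/S2: axisymmetric (KNSS2009 Thms 5.2–5.3,
SereginSverak2009), self-similar (NecasRuzickaSverak1996, Tsai1998).

Novelty: NOVELTY (planner, 2026-08-15; searched BEFORE claiming: `lit search --source zbmath` on "enhanced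
dissipation Navier-Stokes blow-up" (9 rows: PKS–NS with PRESCRIBED Couette/Poiseuille flows
doi:10.1016/j.jfa.2021.108967, arXiv:2312.01069, arXiv:2311.18519, arXiv:2207.13494; transport-noise
NS arXiv:2111.12931, arXiv:2606.19060), "dissipation enhancing flows" (Zlatos2010 =
arXiv:math/0701123, Rowan2024 = arXiv:2401.15001, arXiv:2210.16801, arXiv:2507.11422), "relaxation
enhancing flows dissipation time" (He–Kiselev arXiv:2107.13134), "sparseness regularity
Navier-Stokes vorticity" (BradshawFarhatGrujic2018 = arXiv:1704.05546, arXiv:1303.0257,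
arXiv:1903.03833, arXiv:1909.10408), "Grujić geometric measure regularity criterion" (Grujic2012 =
arXiv:1111.0217), "asymptotic criticality" (GrujicXu2024 = arXiv:1911.00974, Grujić PAFA 7 (2022)),
"kinematic dynamo" since 2023 (arXiv:2407.18028, arXiv:2603.09861, arXiv:2608.02586,
arXiv:2505.23936, arXiv:2504.00855), "regularity criteria at one scale suitable weak solutions"
(WangWuZhou2019, arXiv:1709.01382, arXiv:1811.09927), "local Type I singularities Liouville"
(AlbrittonBarker2019), "Seregin type II blowups" (Seregin2024 = arXiv:2304.04045, arXiv:2606.29468,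
arXiv:2507.08733, arXiv:2402.13229); `lit galaxy search --star all` "relaxation enhancing" (pdf:
CKRZ ckrz11.pdf, Feng–Iyer CNA preprint, X. Xu thesis 'Singularities and mixing in fluid mechanics'
2016, He–Kiselev) and "dissipation enhancing flows"/"relaxation enhancing Navier  [refs: 10.1016/j.jfa.2021.108967, 2312.01069, 2311.18519, 2207.13494, 2111.12931, 2606.19060, math/0701123, 2401.15001, 2210.16801, 2507.11422, 2107.13134, 1704.05546, 1303.0257, 1903.03833, 1909.10408, 1111.0217, 1911.00974, 2407.18028, 2603.09861, 2608.02586, 2505.23936, 2504.00855, 1709.01382, 1811.09927, 2304.04045, 2606.29468, 2507.08733, 2402.13229, math/0509663, 0706.4411, 1908.01941, 1910.05742, ]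

Barriers (technique_class: mixing-enhanced-dissipation supercritical-a-priori-control): BARRIERS (catalogue lean/Literature/Barriers/NavierStokesRegularity read: TaoAveragedBlowup,
TruncatedDyadicBlowup, EnergySupercriticality, DyadicCascadeRegularity, CheapNavierStokesBlowup,
AxisymmetricTypeIExclusion, CriticalNormBlowupNecessity, LeraySelfSimilarBlowupExclusion,
SingularSetDimensionBound, ComplexNavierStokesBlowup, BuckmasterVicolNonuniqueness + the
non-uniqueness/norm-inflation entries (not relevant to a regularity mechanism); negatives index
`ledger negatives --problem NavierStokesRegularity`: 0 refuted statements at filing).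
technique_class: mixing-enhanced-dissipation structure-randomness-dichotomy partial-regularity
supercritical-a-priori-control.
- Literature.Barriers.NavierStokesRegularity.TaoAveragedBlowup (Tao2016AveragedNS Thm 1.5) and
Literature.Barriers.NavierStokesRegularity.TruncatedDyadicBlowup: evaded IN FORM by P and S2 — both
are stated through TRANSPORT of passive scalars by the divergence-free field u (MIX quantifies over
solutions of ∂ₜθ + u·∇θ = Δθ; Lagrangian/skew-adjoint structure), which an averaged bilinear
operator B̃ does not define; a proof of P must use either the exact vorticity/velocity transport
structure or the MIX hypothesis, neither of which transfers to averaged NS, so the barrier does not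
formally bite. Honest caveat: Tao's cascade is a delayed, coherent mode-to-mode transfer — morally
an inhabitant of the STRUCTURED branch; the route bets that coherent transfer is exactly what
S2-type rigidity must kill, and nothing NS-s

Novelty grade: new-combination — ROUTE REVIEW + grade (refuter, 2026-08-15). Grade new-combination: (i) CKRZ/Zlatoš relaxation-enhancement as a per-parabolic-scale classifier of the solution's OWN drift, (ii) Grujić-type 'sparseness/mixedness pays dissipation' as the payoff path, (iii) CKN ε-regularity / Type-I–Liouville technology (refuter refuter-rreview-route-NavierStokesRegula-ab1e3435-0, 2026-08-15T11:22:23Z; prior: ConstantinEtAl2008 (CKRZ relaxation-enhancing flows), Zlatos2010 arXiv:math/0701123, Grujic2012 arXiv:1111.0217, BradshawFarhatGrujic2018 arXiv:1704.05546, KiselevXu2016, IyerXuZlatos2021, FlandoliLuo2021, KNSS2009, AlbrittonBarker2019, WangWuZhou2019)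

History (route lifecycle, newest last):
- 2026-08-25T10:48:05Z · DORMANT — reconciler: no traction for 7.6 d (last activity item-evidence-added at 2026-08-17T19:12:18Z); parked, not closed — `ledger route dormant route-NavierStokesRegu (operator:999:1522246)
- 2026-08-28T21:10:56Z · REACTIVATED — reconciler: reactivated — activity item-evidence-added at 2026-08-28T19:38:46Z after parking at 2026-08-25T10:48:05Z (operator:999:1927110)
- 2026-09-03T10:19:17Z · DORMANT — reconciler: no traction for 5 d (last activity statement-checked at 2026-08-29T09:17:08Z); parked, not closed — `ledger route dormant route-NavierStokesRegulari (operator:999:375600)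

sub-problem: NavierStokesRegularity · status: dormant · opened planner-plancard-NavierStokesRegularity-Navie-4ff427e6-0 2026-08-15T10:56:03Z · rev 2 · ledger route-NavierStokesRegularity-SelfMixingDichotomy
GENERATED by the gate from the ledger (D-0016/17). Provers cite these decls: `theorem foo : Summit.NavierStokesRegularity.NavierStokesRegularity.Theses.SelfMixingDichotomy.<Decl> := …` in Summits/NavierStokesRegularity/NavierStokesRegularity/Theorems/<Name>.lean.
-/

namespace Summit.NavierStokesRegularity.NavierStokesRegularity.Theses.SelfMixingDichotomy

open scoped BigOperators Topology Manifold Classical MeasureTheory ProbabilityTheory Matrix InnerProductSpace ComplexConjugate ContinuousMap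
open Filter Set Function TopologicalSpace MeasureTheory

attribute [summit_statement] _root_.NavierStokesRegularity

open Literature.NS

/-- item stmt-NavierStokesRegularity-1421 · target · rank 0 · open · by planner
why it might fail: Each conjunct forbids one blow-up morphology, so X is Clay-hard in aggregate: P's payoff race is O(1)-vs-O(1) at critical scaling, S2 has no Liouville theorem behind it and tends to 'no non-Type-I blow-up' as δ→0, S1 contains Type I exclusion (KNSS2009, AlbrittonBarker2019 Thm 1.1).
sources: ConstantinEtAl2008, Zlatos2010, Grujic2012, BradshawFarhatGrujic2018, KNSS2009, AlbrittonBarker2019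
[target] X = MixingPayoff ∧ CoherentScaleExclusion ∧ SequentialTypeIExclusion (the three cruxes
below, for ν = 1 finite-energy classical solutions from rapidly decaying data, at a point x₀ and the
final time T). Per-scale trichotomy of the solution's own advection at (T,x₀): cofinitely δ-mixing
(P) / infinitely often high-Re and non-mixing (S2) / infinitely often low-Re (S1); exhaustive by
logic, each branch concludes local boundedness BDD. MIX(u,T,x₀,r,δ): every smooth rapidly-decaying θ
solving ∂ₜθ + u·∇θ = Δθ on [T−r²,T−r²/2]×ℝ³ with supp θ(T−r²) ⊆ B_r(x₀) has ∫θ(T−r²/2)² ≤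
δ²∫θ(T−r²)² (scalar dissipation factor of the drift u at parabolic scale r; diffusivity = viscosity
= 1; Galilean/rotation invariant; pure heat gives c_heat ≈ 0.59, so small δ = quantitatively
relaxation-enhancing in the CKRZ/Zlatoš sense). BDD(u,T,x₀): u bounded on (T−ρ²,T)×B_ρ(x₀) for some
ρ>0. Card: self-mixing-dichotomy-enhanced-dissipation. [sources: ConstantinEtAl2008, Zlatos2010,
Grujic2012, KNSS2009, CKN1982] -/
@[route_item "route-NavierStokesRegularity-SelfMixingDichotomy"]
def Thesis : Prop :=
  (∃ δ : ℝ, 0 < δ ∧ ∀ T : ℝ, 0 < T → ∀ (u : ℝ → EuclideanSpace ℝ (Fin 3) → EuclideanSpace ℝ (Fin 3)) (p : ℝ → EuclideanSpace ℝ (Fin 3) → ℝ), Literature.Analysis.FluidPDE.IsClassicalNSSolutionOn (Set.Ico 0 T) 1 0 u p → Literature.Analysis.FluidPDE.IsLerayHopfOn T 1 0 (u 0) u → Literature.Analysis.FluidPDE.HasRapidSpatialDecay (u 0) → ∀ x₀ : EuclideanSpace ℝ (Fin 3), (∃ r₀ : ℝ, 0 < r₀ ∧ ∀ r ∈ Set.Ioo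 0 r₀, (∀ θ : ℝ → EuclideanSpace ℝ (Fin 3) → ℝ, Literature.Analysis.FluidPDE.IsSmoothSpaceTimeOn (Set.Icc (T - r ^ 2) (T - r ^ 2 / 2)) θ → Literature.Analysis.FluidPDE.HasUniformRapidDecayOn (Set.Icc (T - r ^ 2) (T - r ^ 2 / 2)) θ → (∀ t ∈ (Set.Icc (T - r ^ 2) (T - r ^ 2 / 2)), ∀ x : EuclideanSpace ℝ (Fin 3), Literature.Analysis.FluidPDE.timeDerivWithin (Set.Icc (T - r ^ 2) (T - r ^ 2 / 2)) θ t x + inner ℝ (u t x) (gradient (θ t) x) = Laplacian.laplacian (θ t) x) → Function.support (θ (T - r ^ 2)) ⊆ Metric.ball x₀ r → ∫ x, (θ (T - r ^ 2 / 2) x) ^ 2 ≤ δ ^ 2 * ∫ x, (θ (T - r ^ 2) x) ^ 2)) → (∃ ρ : ℝ, 0 < ρ ∧ ∃ M : ℝ, ∀ t ∈ Set.Ioo (T - ρ ^ 2) T, ∀ x ∈ Metric.ball x₀ ρ, ‖u t x‖ ≤ M)) ∧ (∀ δ : ℝ, 0 < δ → ∃ M : ℝ, ∀ T : ℝ, 0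 < T → ∀ (u : ℝ → EuclideanSpace ℝ (Fin 3) → EuclideanSpace ℝ (Fin 3)) (p : ℝ → EuclideanSpace ℝ (Fin 3) → ℝ), Literature.Analysis.FluidPDE.IsClassicalNSSolutionOn (Set.Ico 0 T) 1 0 u p → Literature.Analysis.FluidPDE.IsLerayHopfOn T 1 0 (u 0) u → Literature.Analysis.FluidPDE.HasRapidSpatialDecay (u 0) → ∀ x₀ : EuclideanSpace ℝ (Fin 3), (∀ r₀ : ℝ, 0 < r₀ → ∃ r ∈ Set.Ioo 0 r₀, ENNReal.ofReal M ≤ Literature.Analysis.FluidPDE.cknC r ((T, x₀) : ℝ × EuclideanSpace ℝ (Fin 3)) u ∧ ¬ (∀ θ : ℝ → EuclideanSpace ℝ (Fin 3) → ℝ, Literature.Analysis.FluidPDE.IsSmoothSpaceTimeOn (Set.Icc (T - r ^ 2) (T - r ^ 2 / 2)) θ → Literature.Analysis.FluidPDE.HasUniformRapidDecayOn (Set.Icc (T - r ^ 2) (T - r ^ 2 / 2)) θ → (∀ t ∈ (Set.Icc (T - r ^ 2) (T - r ^ 2 / 2)), ∀ x : EuclideanSpace ℝ (Fin 3), Literature.Analysis.FluidPDE.timeDerivWithin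 (Set.Icc (T - r ^ 2) (T - r ^ 2 / 2)) θ t x + inner ℝ (u t x) (gradient (θ t) x) = Laplacian.laplacian (θ t) x) → Function.support (θ (T - r ^ 2)) ⊆ Metric.ball x₀ r → ∫ x, (θ (T - r ^ 2 / 2) x) ^ 2 ≤ δ ^ 2 * ∫ x, (θ (T - r ^ 2) x) ^ 2)) → (∃ ρ : ℝ, 0 < ρ ∧ ∃ M : ℝ, ∀ t ∈ Set.Ioo (T - ρ ^ 2) T, ∀ x ∈ Metric.ball x₀ ρ, ‖u t x‖ ≤ M)) ∧ (∀ M : ℝ, ∀ T : ℝ, 0 < T → ∀ (u : ℝ → EuclideanSpace ℝ (Fin 3) → EuclideanSpace ℝ (Fin 3)) (p : ℝ → EuclideanSpace ℝ (Fin 3) → ℝ), Literature.Analysis.FluidPDE.IsClassicalNSSolutionOn (Set.Ico 0 T) 1 0 u p → Literature.Analysis.FluidPDE.IsLerayHopfOn T 1 0 (u 0) u → Literature.Analysis.FluidPDE.HasRapidSpatialDecay (u 0) → ∀ x₀ : EuclideanSpace ℝ (Fin 3), (∀ r₀ : ℝ, 0 < r₀ → ∃ r ∈ Set.Ioo 0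 r₀, Literature.Analysis.FluidPDE.cknC r ((T, x₀) : ℝ × EuclideanSpace ℝ (Fin 3)) u ≤ ENNReal.ofReal M) → (∃ ρ : ℝ, 0 < ρ ∧ ∃ M : ℝ, ∀ t ∈ Set.Ioo (T - ρ ^ 2) T, ∀ x ∈ Metric.ball x₀ ρ, ‖u t x‖ ≤ M))

/-- item stmt-NavierStokesRegularity-1422 · crux · rank 2 · open · by planner
why it might fail: Race with O(1) constants: self-advection cannot dissipate a scale-r blob faster than ~one turnover, the clock of stretching; Lipschitz stirring loses a log (FengIyer2019); the sparseness payoff needs X_{1/2}, only X_{1/3} is a priori (arXiv:1704.05546 p.5). A mixing Type II blow-up kills it.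
sources: ConstantinEtAl2008, Zlatos2010, FengIyer2019, ZelatiDelgadinoElgindi2019, BradshawFarhatGrujic2018, KiselevXu2016
[crux] P, THE PAYOFF (card branch (M), re-posed for SCALARS): there is an absolute δ>0 such that for
every classical Leray–Hopf solution (ν=1) on ℝ³×[0,T) from a rapidly decaying datum and every x₀: if
the drift u is δ-dissipation-enhancing at (T,x₀) at every sufficiently small parabolic scale r
(MIX(u,T,x₀,r,δ) for all r∈(0,r₀)), then u is bounded near (T,x₀). MIX(u,T,x₀,r,δ): every smooth
rapidly-decaying θ solving ∂ₜθ + u·∇θ = Δθ on [T−r²,T−r²/2]×ℝ³ with supp θ(T−r²) ⊆ B_r(x₀) has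
∫θ(T−r²/2)² ≤ δ²∫θ(T−r²)² (scalar dissipation factor of the drift u at parabolic scale r;
diffusivity = viscosity = 1; Galilean/rotation invariant; pure heat gives c_heat ≈ 0.59, so small δ
= quantitatively relaxation-enhancing in the CKRZ/Zlatoš sense). BDD(u,T,x₀): u bounded on
(T−ρ²,T)×B_ρ(x₀) for some ρ>0. Deterministic, self-consistent analogue of convection-induced blow-up
suppression (KiselevXu2016, IyerXuZlatos2021: prescribed stirring, other PDEs) and of the
transport-noise eddy-viscosity control (FlandoliLuo2021). Intended layer-2 path (not filed): MIX on
Q_r ⇒ volumetric sparseness of the super-level sets of |ω| (or |u|) in Q_{r/2} at the analyticity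
scale ⇒ localised Grujić criterion (Gruji -/
@[route_item "route-NavierStokesRegularity-SelfMixingDichotomy"]
def MixingPayoff : Prop :=
  ∃ δ : ℝ, 0 < δ ∧ ∀ T : ℝ, 0 < T → ∀ (u : ℝ → EuclideanSpace ℝ (Fin 3) → EuclideanSpace ℝ (Fin 3)) (p : ℝ → EuclideanSpace ℝ (Fin 3) → ℝ), Literature.Analysis.FluidPDE.IsClassicalNSSolutionOn (Set.Ico 0 T) 1 0 u p → Literature.Analysis.FluidPDE.IsLerayHopfOn T 1 0 (u 0) u → Literature.Analysis.FluidPDE.HasRapidSpatialDecay (u 0) → ∀ x₀ : EuclideanSpace ℝ (Fin 3), (∃ r₀ : ℝ, 0 < r₀ ∧ ∀ r ∈ Set.Ioo 0 r₀, (∀ θ : ℝ → EuclideanSpace ℝ (Fin 3) → ℝ, Literature.Analysis.FluidPDE.IsSmoothSpaceTimeOn (Set.Icc (T - r ^ 2) (T - r ^ 2 / 2)) θ → Literature.Analysis.FluidPDE.HasUniformRapidDecayOn (Set.Icc (T - r ^ 2) (T - r ^ 2 / 2)) θ → (∀ t ∈ (Set.Icc (T - r ^ 2) (T - r ^ 2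 / 2)), ∀ x : EuclideanSpace ℝ (Fin 3), Literature.Analysis.FluidPDE.timeDerivWithin (Set.Icc (T - r ^ 2) (T - r ^ 2 / 2)) θ t x + inner ℝ (u t x) (gradient (θ t) x) = Laplacian.laplacian (θ t) x) → Function.support (θ (T - r ^ 2)) ⊆ Metric.ball x₀ r → ∫ x, (θ (T - r ^ 2 / 2) x) ^ 2 ≤ δ ^ 2 * ∫ x, (θ (T - r ^ 2) x) ^ 2)) → (∃ ρ : ℝ, 0 < ρ ∧ ∃ M : ℝ, ∀ t ∈ Set.Ioo (T - ρ ^ 2) T, ∀ x ∈ Metric.ball x₀ ρ, ‖u t x‖ ≤ M)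

/-- item stmt-NavierStokesRegularity-1423 · crux · rank 3 · open · by planner
why it might fail: Non-mixing ⇔ an H¹ eigenfunction of u·∇ (ConstantinEtAl2008 Thm 1.2), far weaker than symmetry; no Liouville/ε-regularity theorem for near-coherent high-Re profiles; axisymmetric with swirl is open (KNSS2009: Type I only), Hou's arXiv:2107.06509 lives here; as δ→0 it bars all non-Type-I blow-up.
sources: ConstantinEtAl2008, KNSS2009, SereginSverak2009, SereginZajaczkowski2007, Hou2022PotentiallySingularNS, Seregin2024
[crux] S2, THE STRUCTURE BRANCH (card branch (S)): for every δ>0 there is M such that, for every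
classical Leray–Hopf solution (ν=1) from a rapidly decaying datum and every x₀: if along some
sequence r_k→0 the scales are strongly loaded, M ≤ C(r_k) = r_k⁻²∫∫_{Q_{r_k}(T,x₀)}|u|³ (in-tree
cknC), and NOT δ-mixing, ¬MIX(u,T,x₀,r_k,δ), then u is bounded near (T,x₀). MIX(u,T,x₀,r,δ): every
smooth rapidly-decaying θ solving ∂ₜθ + u·∇θ = Δθ on [T−r²,T−r²/2]×ℝ³ with supp θ(T−r²) ⊆ B_r(x₀)
has ∫θ(T−r²/2)² ≤ δ²∫θ(T−r²)² (scalar dissipation factor of the drift u at parabolic scale r;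
diffusivity = viscosity = 1; Galilean/rotation invariant; pure heat gives c_heat ≈ 0.59, so small δ
= quantitatively relaxation-enhancing in the CKRZ/Zlatoš sense). BDD(u,T,x₀): u bounded on
(T−ρ²,T)×B_ρ(x₀) for some ρ>0. Meaning: coherent high-Reynolds eddies (the flows CKRZ characterise
as NOT relaxation-enhancing: u·∇ has H¹ eigenfunctions / non-constant first integrals at scale r —
closed streamlines, vortex cores in near-solid rotation where radial data are not stirred at all)
cannot recur down to r→0 at a singularity. M must grow as δ→0 (at bounded Reynolds number nothing
δ-mixes), hence ∀δ ∃M. Layer 2 fores -/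
@[route_item "route-NavierStokesRegularity-SelfMixingDichotomy"]
def CoherentScaleExclusion : Prop :=
  ∀ δ : ℝ, 0 < δ → ∃ M : ℝ, ∀ T : ℝ, 0 < T → ∀ (u : ℝ → EuclideanSpace ℝ (Fin 3) → EuclideanSpace ℝ (Fin 3)) (p : ℝ → EuclideanSpace ℝ (Fin 3) → ℝ), Literature.Analysis.FluidPDE.IsClassicalNSSolutionOn (Set.Ico 0 T) 1 0 u p → Literature.Analysis.FluidPDE.IsLerayHopfOn T 1 0 (u 0) u → Literature.Analysis.FluidPDE.HasRapidSpatialDecay (u 0) → ∀ x₀ : EuclideanSpace ℝ (Fin 3), (∀ r₀ : ℝ, 0 < r₀ → ∃ r ∈ Set.Ioo 0 r₀, ENNReal.ofReal M ≤ Literature.Analysis.FluidPDE.cknC r ((T, x₀) : ℝ × EuclideanSpace ℝ (Fin 3)) u ∧ ¬ (∀ θ : ℝ → EuclideanSpace ℝ (Fin 3) → ℝ, Literature.Analysis.FluidPDE.IsSmoothSpaceTimeOn (Set.Icc (T - r ^ 2) (T - r ^ 2 / 2)) θ → Literature.Analysis.FluidPDE.HasUniformRapidDecayOn (Set.Icc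 (T - r ^ 2) (T - r ^ 2 / 2)) θ → (∀ t ∈ (Set.Icc (T - r ^ 2) (T - r ^ 2 / 2)), ∀ x : EuclideanSpace ℝ (Fin 3), Literature.Analysis.FluidPDE.timeDerivWithin (Set.Icc (T - r ^ 2) (T - r ^ 2 / 2)) θ t x + inner ℝ (u t x) (gradient (θ t) x) = Laplacian.laplacian (θ t) x) → Function.support (θ (T - r ^ 2)) ⊆ Metric.ball x₀ r → ∫ x, (θ (T - r ^ 2 / 2) x) ^ 2 ≤ δ ^ 2 * ∫ x, (θ (T - r ^ 2) x) ^ 2)) → (∃ ρ : ℝ, 0 < ρ ∧ ∃ M : ℝ, ∀ t ∈ Set.Ioo (T - ρ ^ 2) T, ∀ x ∈ Metric.ball x₀ ρ, ‖u t x‖ ≤ M)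

/-- item stmt-NavierStokesRegularity-1424 · crux · rank 4 · open · by planner
why it might fail: Sup-form = Type I exclusion: open, ⇔ Liouville for Type-I mild bounded ancient solutions (arXiv:1811.00502 Thm 1.1; Seregin2014Notes p.113 Prop 3.11, p.114). Liminf form is stronger: scale-intermittent Type II with Type-I windows evades compactness (ibid. p.101 Prop 1.5 also needs limsup E<M).
sources: KNSS2009, SereginSverak2009, AlbrittonBarker2019, Seregin2014Notes, Seregin2024, WangWuZhou2019
[crux] S1, TYPE-I WINDOWS (card hand-off to Type-I/Liouville exclusions): for every M, every
classical Leray–Hopf solution (ν=1) from a rapidly decaying datum and every x₀: if C(r_k) =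
r_k⁻²∫∫_{Q_{r_k}(T,x₀)}|u|³ ≤ M along some sequence r_k→0 (liminf_{r→0} C(r) ≤ M), then u is bounded
near (T,x₀). Small M is KNOWN (one-scale ε-regularity in terms of the velocity only: WangWuZhou2019;
CKN1982/Lin1998 with pressure), so the content is M ≥ ε: no singular point has Type-I windows at
arbitrarily small scales. The sup-form (C(r) ≤ M for ALL small r) is Type I exclusion in Seregin's
sense (Seregin2014Notes PDF p.113: Type I ⇔ g' = min{sup A, sup C, sup E} < ∞ ⇒ g < ∞, Prop 3.11;
Seregin2024 p.2 (1.1)), which the KNSS Liouville conjecture would settle (Seregin2014Notes PDF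
p.114; AlbrittonBarker2019 Thm 1.1; route TypeILiouville items 0057/0058) — progress there is
shared. The pigeonhole in the Assembly also supplies ¬MIX(r_k,δ₀) at the same scales; not used in
the statement (it adds nothing for δ₀ below the bounded-Reynolds mixing floor) but available to a
layer-2 split. Layer 2 foreseen (not filed): liminf ⇒ limsup bootstrap (Seregin2014Notes PDF p.101
Prop 1.5 pattern: small liminf E + -/
@[route_item "route-NavierStokesRegularity-SelfMixingDichotomy"]
def SequentialTypeIExclusion : Prop :=
  ∀ M : ℝ, ∀ T : ℝ, 0 < T → ∀ (u : ℝ → EuclideanSpace ℝ (Fin 3) → EuclideanSpace ℝ (Fin 3)) (p : ℝ → EuclideanSpace ℝ (Fin 3) → ℝ), Literature.Analysis.FluidPDE.IsClassicalNSSolutionOn (Set.Ico 0 T) 1 0 u p → Literature.Analysis.FluidPDE.IsLerayHopfOn T 1 0 (u 0) u → Literature.Analysis.FluidPDE.HasRapidSpatialDecay (u 0) → ∀ x₀ : EuclideanSpace ℝ (Fin 3), (∀ r₀ : ℝ, 0 < r₀ → ∃ r ∈ Set.Ioo 0 r₀, Literature.Analysis.FluidPDE.cknC r ((T, x₀) :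 ℝ × EuclideanSpace ℝ (Fin 3)) u ≤ ENNReal.ofReal M) → (∃ ρ : ℝ, 0 < ρ ∧ ∃ M : ℝ, ∀ t ∈ Set.Ioo (T - ρ ^ 2) T, ∀ x ∈ Metric.ball x₀ ρ, ‖u t x‖ ≤ M)

/-- item stmt-NavierStokesRegularity-0055 · support · rank 9 · closed · proved by Summit.NavierStokesRegularity.NavierStokesRegularity.Theorems.typeICertificateLadder_noBlowupToClay_proof @ 8d57e70af7e2 (prover) · by planner
sources: Leray1934, Fefferman2000
Given NoBlowup, build the Clay (A) solution: local finite-energy classical solution for smooth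
divergence-free rapidly decaying data (Leray 1934 §III / Fujita–Kato 1964 + LPS smoothing), continue
past every T using NoBlowup, glue by weak–strong uniqueness (Prodi–Serrin), bounded energy from the
energy inequality, and convert with
Literature.Analysis.FluidPDE.isNavierStokesSolution_and_smooth_iff. Blow-up at spatial infinity is
excluded by CKN ε-regularity applied far out. May take named Literature facts (leray_existence_R3,
ladyzhenskaya_prodi_serrin, weak_strong_uniqueness, fujita_kato_local) as hypotheses if the grounder
so rules. -/
@[route_item "route-NavierStokesRegularity-SelfMixingDichotomy"]
def NoBlowupToClay : Prop :=
  (∀ (ν T : ℝ), 0 < ν → 0 < T → ∀ (u : ℝ → EuclideanSpace ℝ (Fin 3) → EuclideanSpace ℝ (Fin 3)) (p : ℝ → EuclideanSpace ℝ (Fin 3) → ℝ), Literature.Analysis.FluidPDE.IsClassicalNSSolutionOn (Set.Ico 0 T) ν 0 u p → Literature.Analysis.FluidPDE.IsLerayHopfOn T ν 0 (u 0) u → Literature.Analysis.FluidPDE.HasRapidSpatialDecay (u 0) → Literature.Analysis.FluidPDE.HasSmoothExtensionPast ν 0 u T) → NavierStokesRegularity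

/-- `NoBlowupToClay` holds: proved by `Summit.NavierStokesRegularity.NavierStokesRegularity.Theorems.typeICertificateLadder_noBlowupToClay_proof` @ 8d57e70af7e2. -/
theorem NoBlowupToClay_holds : NoBlowupToClay := _root_.Summit.NavierStokesRegularity.NavierStokesRegularity.Theorems.typeICertificateLadder_noBlowupToClay_proof

/-- item stmt-NavierStokesRegularity-1425 · support · rank 9 · closed · proved by Summit.NavierStokesRegularity.NavierStokesRegularity.Theorems.selfMixingDichotomy_localToGlobal_proof (prover) · by planner
sources: CKN1982, Tao2011, RobinsonRodrigoSadowski2016, Leray1934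
[support] GLUE: if every ν=1 classical Leray–Hopf solution from a rapidly decaying datum is bounded
near (T,x₀) for every x₀ (BDD everywhere at the final time), then NoBlowup holds for every ν>0
(HasSmoothExtensionPast). Standard, ~1–2 files: (i) viscosity scaling v(s,y) = ν⁻¹u(s/ν,y), q =
ν⁻²p(s/ν,y) (in-tree ClassicalSolutionRescale / LerayHopfNSRescale); (ii) far field: a Leray–Hopf
solution is bounded on (T/2,T)×{|x|>R} (CKN1982 Thm C/D; in-tree
LerayFarFieldEpsilonRegularity(Slab): IsSuitableWeakSolutionOn.farField_bound_of_ckn_decay,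
leray_solution_ckn_decay); (iii) compactness of closedBall 0 R: finitely many balls B_ρ(x₀) ⇒ u
bounded on (T−ρ₀²,T)×ℝ³; (iv) [0,T−ρ₀²]: Tao2011 closed-slab Sobolev bounds
(tao2011_hasBoundedSobolevNormsOn, linfty_bound_of_hasBoundedSobolevNormsOn, as in route
VorticityGeometry Assembly3); (v) hasSmoothExtensionPast_of_bounded_holds
(RobinsonRodrigoSadowski2016 Thm 8.17, PROVED in tree). May take the named facts of (ii),(iv) as
hypotheses if the grounder so rules. -/
@[route_item "route-NavierStokesRegularity-SelfMixingDichotomy"]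
def LocalToGlobal : Prop :=
  (∀ T : ℝ, 0 < T → ∀ (u : ℝ → EuclideanSpace ℝ (Fin 3) → EuclideanSpace ℝ (Fin 3)) (p : ℝ → EuclideanSpace ℝ (Fin 3) → ℝ), Literature.Analysis.FluidPDE.IsClassicalNSSolutionOn (Set.Ico 0 T) 1 0 u p → Literature.Analysis.FluidPDE.IsLerayHopfOn T 1 0 (u 0) u → Literature.Analysis.FluidPDE.HasRapidSpatialDecay (u 0) → ∀ x₀ : EuclideanSpace ℝ (Fin 3), (∃ ρ : ℝ, 0 < ρ ∧ ∃ M : ℝ, ∀ t ∈ Set.Ioo (T - ρ ^ 2) T, ∀ x ∈ Metric.ball x₀ ρ, ‖u t x‖ ≤ M)) → (∀ (ν T : ℝ), 0 < ν → 0 < T → ∀ (u : ℝ → EuclideanSpace ℝ (Fin 3) → EuclideanSpace ℝ (Fin 3)) (p : ℝ → EuclideanSpace ℝ (Fin 3) → ℝ), Literature.Analysis.FluidPDE.IsClassicalNSSolutionOn (Set.Ico 0 T) ν 0 u p → Literature.Analysis.FluidPDE.IsLerayHopfOn T ν 0 (u 0) u → Literature.Analysis.FluidPDE.HasRapidSpatialDecay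 (u 0) → Literature.Analysis.FluidPDE.HasSmoothExtensionPast ν 0 u T)

-- `LocalToGlobal` holds: proved by `Summit.NavierStokesRegularity.NavierStokesRegularity.Theorems.selfMixingDichotomy_localToGlobal_proof` (its module imports this route file, so no `_holds` link can be stated here).

/-- item stmt-NavierStokesRegularity-1426 · assembly · rank 1 · closed · proved by Summit.NavierStokesRegularity.NavierStokesRegularity.Theorems.selfMixingDichotomy_assembly_proof (prover) · by planner
sources: Fefferman2000, CKN1982
[assembly] MixingPayoff → CoherentScaleExclusion → SequentialTypeIExclusion → LocalToGlobal →
NoBlowupToClay → NavierStokesRegularity. PURE LOGIC, verified sorry-free in the planner's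
Sketch.lean (theorem assembly_holds, ~20 lines): take δ from P and M from S2(δ); fix a ν=1 solution
and x₀; by_cases (∃r₀, ∀r<r₀, MIX(r,δ)) → P; else ∀r₀ ∃r<r₀ ¬MIX(r,δ); by_cases (∀r₀ ∃r<r₀, M ≤ C(r)
∧ ¬MIX(r,δ)) → S2; else ∃r₁ ∀r<r₁ (M ≤ C(r) → MIX(r,δ)), so the non-mixing scales below r₁ have C(r)
< M → S1 with M; hence BDD at every (T,x₀) for ν=1; LocalToGlobal gives NoBlowup for all ν;
NoBlowupToClay gives Clay (A). -/
@[route_item "route-NavierStokesRegularity-SelfMixingDichotomy"]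
def Assembly : Prop :=
  MixingPayoff → CoherentScaleExclusion → SequentialTypeIExclusion → LocalToGlobal → NoBlowupToClay → NavierStokesRegularity

-- `Assembly` holds: proved by `Summit.NavierStokesRegularity.NavierStokesRegularity.Theorems.selfMixingDichotomy_assembly_proof` (its module imports this route file, so no `_holds` link can be stated here).

/-! D-0027 §2.1 — DECIDING THEOREM (planner-authored via `route open/edit --closes-file`; by planner-rbadge-NavierStokesRegularity-SelfMixi-a7a24949-g2-0 2026-08-15T16:13:51Z):
its hypotheses are this route's items and its conclusion the sub-problem Statement (glue_lint), and it elaborates with this file. -/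

@[closes "route-NavierStokesRegularity-SelfMixingDichotomy"] theorem closes (hP : MixingPayoff) (hS2 : CoherentScaleExclusion) (hS1 : SequentialTypeIExclusion)
    (hLG : LocalToGlobal) (hClay : NoBlowupToClay) : NavierStokesRegularity := by
  -- NoBlowupToClay: NoBlowup (all ν) → Clay (A); LocalToGlobal: local boundedness at every final-time
  -- point of every ν = 1 solution → NoBlowup (all ν). Remains: BDD at (T,x₀) by the scale trichotomy.
  apply hClay
  apply hLG
  intro T hT u p hcl hLH hdec x₀
  obtain ⟨δ, hδ, hPδ⟩ := hP
  obtain ⟨M, hM⟩ := hS2 δ hδ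
  have hP' := hPδ T hT u p hcl hLH hdec x₀
  have hS2' := hM T hT u p hcl hLH hdec x₀
  have hS1' := hS1 M T hT u p hcl hLH hdec x₀
  -- Pure logic: if BDD failed, S1 says low-Re scales stop below some r₀, S2 says non-mixing high-Re
  -- scales stop below some r₁, hence every scale below min r₀ r₁ is δ-mixing and P gives BDD.
  by_contra hnb
  refine hnb (hS1' fun r₀ hr₀ => ?_)
  by_contra hlow
  refine hnb (hS2' fun r₁ hr₁ => ?_)
  by_contra hhigh
  refine hnb (hP' ⟨min r₀ r₁, lt_min hr₀ hr₁, fun r hr => ?_⟩)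
  by_contra hmix
  by_cases hle : Literature.Analysis.FluidPDE.cknC r ((T, x₀) : ℝ × EuclideanSpace ℝ (Fin 3)) u ≤ ENNReal.ofReal M
  · exact hlow ⟨r, ⟨hr.1, lt_of_lt_of_le hr.2 (min_le_left r₀ r₁)⟩, hle⟩
  · exact hhigh ⟨r, ⟨hr.1, lt_of_lt_of_le hr.2 (min_le_right r₀ r₁)⟩, (not_le.mp hle).le, hmix⟩

end Summit.NavierStokesRegularity.NavierStokesRegularity.Theses.SelfMixingDichotomy
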